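import Mathlib
import Summits.NavierStokesRegularity.OSWSelfSimilar.SheetLpTestIdentity
import Summits.NavierStokesRegularity.OSWSelfSimilar.SheetLpPower
import Summits.NavierStokesRegularity.OSWSelfSimilar.SheetNSLineMomentSignLaw
import Summits.NavierStokesRegularity.OSWSelfSimilar.SheetRWeakProfilePV
import Literature.Analysis.Fourier.HilbertTransformLineL2
import HarnessLib

/-!
# Viscous gCLM/OSW profile MODEL: the SIGN-FREE `L^p` FAMILY and «the `a ≤ −1` half of the NS-type line is EMPTY» (kernel)

HONEST FRAMING (cell ns-blowup GROUP B «PROFILE SEARCH», zone Z3 = the 1-D viscous gCLM/OSW sheet; human rulings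
D-0035/D-0074): **1-D MODEL; not Euler, not Navier–Stokes; «violates: none — MODEL».** Nothing here is a statement about NS.

THE STATEMENTS (census level, CENSUS-Z3 row Z3-E12⁻ clause (i′), steady half; the cell's word for `a ≤ −1` so far is the PRINT
citation «global well-posedness with `Λ^γ`, `γ ∈ [|a|⁻¹, 2]`» [Chen 2020, Thm 1.5] plus the E-SIGNED kernel exclusions
`nsTypeLine_ESigned_empty_of_a_le_neg_one` (p492034) / `nsTypeLine_ESigned_empty_of_a_neg` (p540197) and the single sign-free point
`a = −2` (`trivial_of_a_eq_neg_two`, energy identity)). For a `C²` profile `Ω` with `Ω(0) = 0`, `|Ω′| ≤ M`, envelope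
`|Ω(ξ)| ≤ C/(1+ξ²)`, MODEL velocity `𝒰′ = HΩ` (GENUINE `hilbertTransform`) with `𝒰Ω → 0` at `+∞`, solving
`F₁(c_ω, c_l, a, b = 1, ε; HΩ, 𝒰, Ω) ≡ 0` on `(0,∞)` with `ε ≥ 0`:
* `lp_family_le` — **THE SIGN-FREE `L^p` FAMILY**: for EVERY real `p ≥ 1`,
    `(p c_ω − c_l) ∫₀^∞ |Ω|^p ≤ (a + p) ∫₀^∞ (HΩ)|Ω|^p`.
  (`p = 1`: the sign-free form of the half-line identity (★) — `abs_floor`; `p = 2`: the energy identity (E) with the dissipation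
  dropped.) NO sign hypothesis, NO parity beyond `Ω(0) = 0`, ANY `c_l`.
* `sheet_empty_of_a_le_neg_one` — **for `a ≤ −1` the whole collapse sheet `{c_l < |a| c_ω}` is EMPTY, sign-free, every `ε ≥ 0`**:
  at `p := |a|` the nonlocal term has coefficient `a + p = 0`, so `(|a|c_ω − c_l)‖Ω‖_{L^{|a|}(0,∞)}^{|a|} ≤ 0`, `Ω ≡ 0` (odd class).
* `nsTypeLine_empty_of_a_le_neg_one` — **THE CENSUS DECL: on the NS-type line `c_l = c_ω/2` (`c_ω > 0`), for every `a ≤ −1` and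
  every `ε ≥ 0` there is NO non-trivial odd `C²` profile of the class** — binders ⊂ those of `nsTypeLine_ESigned_empty_of_a_neg`
  MINUS `hsign`, `hU0`, `iUOm`, `iH`, `hdOm1`, with `ha : a ≤ −1`, `hε : 0 ≤ ε`, and `hUOm` weakened to `𝒰Ω → 0`.
MECHANISM = THE `L^{|a|}` TEST (the steady shadow of the monotone quantity `‖ω(t)‖_{L^{|a|}}` behind [Chen 2020, Thm 1.5]; cited
for context via `Literature.Analysis.FluidPDE.Chen2020DissipativeGCLM`, not restated): the convex-test inequality
`SheetLpTestIdentity.integral_Ioi_test_le` with the regularised power `Φ_δ(s) = (s²+δ)^{p/2} − δ^{p/2}` of `SheetLpPower`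
(`Φ_δ″ ≥ 0` for `p ≥ 1`; the dissipation `ε∫Ω′²Φ_δ″(Ω) ≥ 0` is dropped), then `δ → 0⁺` by dominated convergence with the
dominating function `K|Ω|(1 + |HΩ|) ∈ L¹` (`Ω ∈ L¹`; `Ω, HΩ ∈ L²` by the tree isometry `memLp_two_hilbertTransform`).
READING it would support (MODEL, steady; the lead's to letter): the clause (i′) steady picture BY KERNEL becomes «`a ≤ −1` ⇒ NONE
(sign-free, every `ε ≥ 0`) · `−1 < a < 0` ⇒ only sign-changing profiles with a positive `ξ⁻²` tail ([g12]) AND the mass–stretching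
floor `∫₀^∞(HΩ)|Ω| ≥ (c_ω − c_l)/(1+a)·∫₀^∞|Ω|` (`p = 1`) · `a = 0` ⇒ NONE ([g13]) · `a > 0` ⇒ negative tail (E½)».
NOT PROVED HERE: anything for `−1 < a` beyond the inequalities; anything dynamic; profiles outside the class (slower tails,
`𝒰Ω ↛ 0`); existence of E½; anything about Euler or NS. No definitions; standard axioms.
bears_on: LADDER-NS N5 / zone Z3 clause (i′) (CENSUS-Z3 v2.14 §0) → N1 linear core; SELFSIM-NOGO M7/M8 MODEL side.
-/

noncomputable section
open Set Filter Topology MeasureTheory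
open scoped Real

namespace Summit.NavierStokesRegularity.OSWSelfSimilar
namespace SheetHalfLine
open HouLuoOriginLaws (F1)
open Literature.Analysis.Fourier

/-! ### The sign-free `L^p` family -/

/-- **THE SIGN-FREE `L^p` FAMILY of the frozen-`ε` gCLM/OSW sheet on the half-line.** Let `Ω` be `C²` (`Ω′ = dOm`, `Ω″ = ddOm`)
with `Ω(0) = 0`, `|Ω′| ≤ M`, `|Ω(ξ)| ≤ C/(1+ξ²)`, let `𝒰′ = HΩ` (`H = hilbertTransform Ω`) with `𝒰(ξ)Ω(ξ) → 0` at `+∞`, and let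
`F₁(c_ω, c_l, a, 1, ε; HΩ, 𝒰, Ω) ≡ 0` on `(0,∞)` with `ε ≥ 0`. Then for every real `p ≥ 1`:
`(p c_ω − c_l) ∫₀^∞ |Ω|^p − (a + p) ∫₀^∞ (HΩ)|Ω|^p ≤ 0`.
Proof: `integral_Ioi_test_le` with `Φ_δ(s) = (s²+δ)^{p/2} − δ^{p/2}`, `0 < δ ≤ 1`, then `δ → 0⁺` (dominated convergence, bound
`K|Ω|(1+|HΩ|)`). [new here — MODEL] -/
theorem lp_family_le (cω cl a ε M C p : ℝ) (U Om dOm ddOm : ℝ → ℝ) (hε : 0 ≤ ε) (hp : 1 ≤ p)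
    (hOm0 : Om 0 = 0)
    (hOm : ∀ ξ, HasDerivAt Om (dOm ξ) ξ) (hdOm : ∀ ξ, HasDerivAt dOm (ddOm ξ) ξ)
    (hM : ∀ y, |dOm y| ≤ M) (hC : ∀ y, |Om y| ≤ C / (1 + y ^ 2))
    (hU : ∀ ξ, HasDerivAt U (hilbertTransform Om ξ) ξ)
    (hF : ∀ ξ ∈ Ioi (0:ℝ), F1 cω cl a 1 ε (hilbertTransform Om) U Om dOm ddOm (fun _ => 0) ξ = 0)
    (hUOm : Tendsto (fun ξ => U ξ * Om ξ) atTop (𝓝 0)) :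
    (p * cω - cl) * (∫ ξ in Ioi (0:ℝ), |Om ξ| ^ p)
      - (a + p) * (∫ ξ in Ioi (0:ℝ), hilbertTransform Om ξ * |Om ξ| ^ p) ≤ 0 := by
  have hp0 : 0 < p := by linarith
  -- the profile class
  have hc : Continuous Om := continuous_iff_continuousAt.mpr fun x => (hOm x).continuousAt
  have hdOmc : Continuous dOm := continuous_iff_continuousAt.mpr fun x => (hdOm x).continuousAt
  have hC0 : 0 ≤ C := env_const_nonneg hC
  have hCb : ∀ y, |Om y| ≤ C := fun y => (hC y).trans (div_le_self hC0 (by nlinarith [sq_nonneg y]))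
  have hΩi : Integrable Om := integrable_of_env hc hC
  have hΩ2 : MemLp Om 2 := memLp_two_of_env hc hC
  have hsymm := integrableOn_symmIntegrand_of_hasDerivAt hOm hdOmc hΩi
  have h1 : ContDiff ℝ 1 Om := by
    rw [contDiff_one_iff_deriv]
    exact ⟨fun y => (hOm y).differentiableAt, by
      rw [show deriv Om = dOm from funext fun y => (hOm y).deriv]; exact hdOmc⟩
  set H : ℝ → ℝ := hilbertTransform Om with hHdef
  have hHc : Continuous H := SheetRWeakProfilePV.continuous_hilbertTransform_of_contDiff h1 hΩi
  have hH2 : MemLp H 2 := memLp_two_hilbertTransform hΩi hΩ2 (ae_of_all _ hsymm)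
  have hHΩ : Integrable (fun ξ => H ξ * Om ξ) := hH2.integrable_mul hΩ2
  -- the integrable envelope pieces
  have iA : Integrable fun ξ => |Om ξ| := hΩi.abs
  have iB : Integrable fun ξ => |H ξ * Om ξ| := hHΩ.abs
  -- `ξΩ → 0`
  have hξOm : Tendsto (fun ξ => ξ * Om ξ) atTop (𝓝 0) := by
    have hlim : Tendsto (fun ξ : ℝ => C / ξ) atTop (𝓝 0) := tendsto_const_nhds.div_atTop tendsto_id
    refine squeeze_zero_norm' ?_ hlim
    filter_upwards [Ioi_mem_atTop (0:ℝ)] with ξ hξ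
    rw [norm_mul, Real.norm_eq_abs, Real.norm_eq_abs, abs_of_pos hξ]
    have h := hC ξ
    rw [le_div_iff₀ hξ]
    calc ξ * |Om ξ| * ξ = ξ ^ 2 * |Om ξ| := by ring
      _ ≤ ξ ^ 2 * (C / (1 + ξ ^ 2)) := mul_le_mul_of_nonneg_left h (sq_nonneg ξ)
      _ ≤ C := by
          rw [← mul_div_assoc, div_le_iff₀ (by positivity)]
          nlinarith [sq_nonneg ξ]
  -- the `δ`-uniform linear bounds for the two test quantities
  obtain ⟨K₁, hK₁0, hK₁⟩ := powReg_le_linear (p := p) hp hC0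
  obtain ⟨K₂, hK₂0, hK₂⟩ := mul_dPowReg_le_linear (p := p) hp hC0
  -- STEP 1: for every `0 < δ ≤ 1`, the convex-test inequality with `Φ_δ`
  have hstep : ∀ δ : ℝ, 0 < δ → δ ≤ 1 →
      (∫ ξ in Ioi (0:ℝ), (cω * (Om ξ * (p * Om ξ * (Om ξ ^ 2 + δ) ^ (p / 2 - 1)))
        - cl * ((Om ξ ^ 2 + δ) ^ (p / 2) - δ ^ (p / 2))
        - a * (H ξ * ((Om ξ ^ 2 + δ) ^ (p / 2) - δ ^ (p / 2)))
        - 1 * (H ξ * Om ξ * (p * Om ξ * (Om ξ ^ 2 + δ) ^ (p / 2 - 1)))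
        - (fun _ : ℝ => (0:ℝ)) ξ * (p * Om ξ * (Om ξ ^ 2 + δ) ^ (p / 2 - 1)))) ≤ 0 := by
    intro δ hδ hδ1
    -- abbreviations for the test function and its derivatives
    set Φ : ℝ → ℝ := fun s => (s ^ 2 + δ) ^ (p / 2) - δ ^ (p / 2) with hΦ
    set dΦ : ℝ → ℝ := fun s => p * s * (s ^ 2 + δ) ^ (p / 2 - 1) with hdΦ
    set ddΦ : ℝ → ℝ := fun s => p * (s ^ 2 + δ) ^ (p / 2 - 2) * ((p - 1) * s ^ 2 + δ) with hddΦ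
    have hΦd : ∀ s, HasDerivAt Φ (dΦ s) s := fun s => hasDerivAt_powReg p hδ s
    have hdΦd : ∀ s, HasDerivAt dΦ (ddΦ s) s := fun s => hasDerivAt_dPowReg p hδ s
    have hΦc : Continuous Φ := continuous_iff_continuousAt.mpr fun s => (hΦd s).continuousAt
    have hdΦc : Continuous dΦ := continuous_iff_continuousAt.mpr fun s => (hdΦd s).continuousAt
    have hddΦc : Continuous ddΦ := continuous_ddPowReg p hδ
    have hddΦ0 : ∀ s, 0 ≤ ddΦ s := fun s => ddPowReg_nonneg hp hδ s
    have hΦ0 : Φ 0 = 0 := powReg_zero p δ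
    have hdΦ0 : dΦ 0 = 0 := dPowReg_zero p δ
    -- pointwise bounds on the profile
    have hb1 : ∀ ξ, 0 ≤ Φ (Om ξ) ∧ Φ (Om ξ) ≤ K₁ * |Om ξ| := fun ξ =>
      ⟨powReg_nonneg hp0.le hδ.le (Om ξ), hK₁ δ hδ hδ1 (Om ξ) (hCb ξ)⟩
    have hb2 : ∀ ξ, 0 ≤ Om ξ * dΦ (Om ξ) ∧ Om ξ * dΦ (Om ξ) ≤ K₂ * |Om ξ| := fun ξ =>
      ⟨mul_dPowReg_nonneg hp0.le hδ.le (Om ξ), hK₂ δ hδ hδ1 (Om ξ) (hCb ξ)⟩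
    -- the integrand and its integrability on `(0,∞)` (dominated by `K|Ω|(1+|HΩ|)`)
    have hIc : Continuous fun ξ => cω * (Om ξ * dΦ (Om ξ)) - cl * Φ (Om ξ) - a * (H ξ * Φ (Om ξ))
        - 1 * (H ξ * Om ξ * dΦ (Om ξ)) - (fun _ : ℝ => (0:ℝ)) ξ * dΦ (Om ξ) :=
      ((((continuous_const.mul (hc.mul (hdΦc.comp hc))).sub (continuous_const.mul (hΦc.comp hc))).sub
        (continuous_const.mul (hHc.mul (hΦc.comp hc)))).sub
        (continuous_const.mul ((hHc.mul hc).mul (hdΦc.comp hc)))).sub (continuous_const.mul (hdΦc.comp hc))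
    have hIbound : ∀ ξ, |cω * (Om ξ * dΦ (Om ξ)) - cl * Φ (Om ξ) - a * (H ξ * Φ (Om ξ))
        - 1 * (H ξ * Om ξ * dΦ (Om ξ)) - (fun _ : ℝ => (0:ℝ)) ξ * dΦ (Om ξ)|
        ≤ (|cω| * K₂ + |cl| * K₁) * |Om ξ| + (|a| * K₁ + K₂) * |H ξ * Om ξ| := by
      intro ξ
      obtain ⟨h1a, h1b⟩ := hb1 ξ
      obtain ⟨h2a, h2b⟩ := hb2 ξ
      have e0 : (fun _ : ℝ => (0:ℝ)) ξ * dΦ (Om ξ) = 0 := by simp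
      rw [e0, sub_zero]
      have t1 : |cω * (Om ξ * dΦ (Om ξ))| ≤ |cω| * (K₂ * |Om ξ|) := by
        rw [abs_mul, abs_of_nonneg h2a]; exact mul_le_mul_of_nonneg_left h2b (abs_nonneg _)
      have t2 : |cl * Φ (Om ξ)| ≤ |cl| * (K₁ * |Om ξ|) := by
        rw [abs_mul, abs_of_nonneg h1a]; exact mul_le_mul_of_nonneg_left h1b (abs_nonneg _)
      have t3 : |a * (H ξ * Φ (Om ξ))| ≤ |a| * (K₁ * |H ξ * Om ξ|) := by
        rw [abs_mul, abs_mul, abs_of_nonneg h1a, abs_mul]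
        refine mul_le_mul_of_nonneg_left ?_ (abs_nonneg _)
        calc |H ξ| * Φ (Om ξ) ≤ |H ξ| * (K₁ * |Om ξ|) := mul_le_mul_of_nonneg_left h1b (abs_nonneg _)
          _ = K₁ * (|H ξ| * |Om ξ|) := by ring
      have t4 : |1 * (H ξ * Om ξ * dΦ (Om ξ))| ≤ K₂ * |H ξ * Om ξ| := by
        rw [one_mul, show H ξ * Om ξ * dΦ (Om ξ) = H ξ * (Om ξ * dΦ (Om ξ)) by ring, abs_mul,
          abs_of_nonneg h2a, abs_mul]
        calc |H ξ| * (Om ξ * dΦ (Om ξ)) ≤ |H ξ| * (K₂ * |Om ξ|) := mul_le_mul_of_nonneg_left h2b (abs_nonneg _)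
          _ = K₂ * (|H ξ| * |Om ξ|) := by ring
      calc _ ≤ |cω * (Om ξ * dΦ (Om ξ))| + |cl * Φ (Om ξ)| + |a * (H ξ * Φ (Om ξ))|
            + |1 * (H ξ * Om ξ * dΦ (Om ξ))| := by
            have := abs_sub (cω * (Om ξ * dΦ (Om ξ)) - cl * Φ (Om ξ) - a * (H ξ * Φ (Om ξ)))
              (1 * (H ξ * Om ξ * dΦ (Om ξ)))
            have := abs_sub (cω * (Om ξ * dΦ (Om ξ)) - cl * Φ (Om ξ)) (a * (H ξ * Φ (Om ξ)))
            have := abs_sub (cω * (Om ξ * dΦ (Om ξ))) (cl * Φ (Om ξ))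
            linarith
        _ ≤ |cω| * (K₂ * |Om ξ|) + |cl| * (K₁ * |Om ξ|) + |a| * (K₁ * |H ξ * Om ξ|) + K₂ * |H ξ * Om ξ| := by
            linarith
        _ = (|cω| * K₂ + |cl| * K₁) * |Om ξ| + (|a| * K₁ + K₂) * |H ξ * Om ξ| := by ring
    have iI : IntegrableOn (fun ξ => cω * (Om ξ * dΦ (Om ξ)) - cl * Φ (Om ξ) - a * (H ξ * Φ (Om ξ))
        - 1 * (H ξ * Om ξ * dΦ (Om ξ)) - (fun _ : ℝ => (0:ℝ)) ξ * dΦ (Om ξ)) (Ioi 0) := by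
      refine Integrable.integrableOn ?_
      refine ((iA.const_mul (|cω| * K₂ + |cl| * K₁)).add (iB.const_mul (|a| * K₁ + K₂))).mono' hIc.aestronglyMeasurable
        (ae_of_all _ fun ξ => ?_)
      rw [Real.norm_eq_abs]
      exact hIbound ξ
    -- the three boundary terms
    have hlim1 : Tendsto (fun ξ => ξ * Φ (Om ξ)) atTop (𝓝 0) := by
      have hK : Tendsto (fun ξ => K₁ * (|ξ| * |Om ξ|)) atTop (𝓝 0) := by
        simpa [abs_mul] using (hξOm.abs).const_mul K₁
      refine squeeze_zero_norm (fun ξ => ?_) hK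
      rw [Real.norm_eq_abs, abs_mul, abs_of_nonneg (hb1 ξ).1]
      calc |ξ| * Φ (Om ξ) ≤ |ξ| * (K₁ * |Om ξ|) := mul_le_mul_of_nonneg_left (hb1 ξ).2 (abs_nonneg _)
        _ = K₁ * (|ξ| * |Om ξ|) := by ring
    have hlim2 : Tendsto (fun ξ => U ξ * Φ (Om ξ)) atTop (𝓝 0) := by
      have hK : Tendsto (fun ξ => K₁ * (|U ξ| * |Om ξ|)) atTop (𝓝 0) := by
        simpa [abs_mul] using (hUOm.abs).const_mul K₁
      refine squeeze_zero_norm (fun ξ => ?_) hK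
      rw [Real.norm_eq_abs, abs_mul, abs_of_nonneg (hb1 ξ).1]
      calc |U ξ| * Φ (Om ξ) ≤ |U ξ| * (K₁ * |Om ξ|) := mul_le_mul_of_nonneg_left (hb1 ξ).2 (abs_nonneg _)
        _ = K₁ * (|U ξ| * |Om ξ|) := by ring
    have hlim3 : Tendsto (fun ξ => dOm ξ * dΦ (Om ξ)) atTop (𝓝 0) := by
      obtain ⟨K₃, hK₃0, hK₃⟩ := abs_dPowReg_le_linear p hδ hC0
      have hΩ0 : Tendsto (fun ξ => |M| * (K₃ * |Om ξ|)) atTop (𝓝 0) := by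
        simpa using ((tendsto_zero_of_env hC).abs.const_mul K₃).const_mul |M|
      refine squeeze_zero_norm (fun ξ => ?_) hΩ0
      rw [norm_mul, Real.norm_eq_abs, Real.norm_eq_abs]
      have hMb : |dOm ξ| ≤ |M| := (hM ξ).trans (le_abs_self M)
      exact mul_le_mul hMb (hK₃ (Om ξ) (hCb ξ)) (abs_nonneg _) (abs_nonneg _)
    exact integral_Ioi_test_le cω cl a 1 ε H U Om dOm ddOm (fun _ => 0) Φ dΦ ddΦ hε hΦd hdΦd hddΦc hddΦ0 hΦ0 hdΦ0
      hU hOm hdOm hOm0 hF iI hlim1 hlim2 hlim3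
  -- STEP 2: `δ → 0⁺` by dominated convergence
  have iAp : Integrable fun ξ => |Om ξ| ^ p := by
    refine (iA.const_mul (C ^ (p - 1))).mono' ((continuous_abs.comp hc).rpow_const fun _ => Or.inr hp0.le).aestronglyMeasurable
      (ae_of_all _ fun ξ => ?_)
    rw [Real.norm_eq_abs, abs_of_nonneg (Real.rpow_nonneg (abs_nonneg _) _)]
    exact abs_rpow_le_linear hp (hCb ξ)
  have iBp : Integrable fun ξ => H ξ * |Om ξ| ^ p := by
    refine (iB.const_mul (C ^ (p - 1))).mono'
      (hHc.mul ((continuous_abs.comp hc).rpow_const fun _ => Or.inr hp0.le)).aestronglyMeasurable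
      (ae_of_all _ fun ξ => ?_)
    rw [Real.norm_eq_abs, abs_mul, abs_of_nonneg (Real.rpow_nonneg (abs_nonneg _) _), abs_mul]
    calc |H ξ| * |Om ξ| ^ p ≤ |H ξ| * (C ^ (p - 1) * |Om ξ|) :=
          mul_le_mul_of_nonneg_left (abs_rpow_le_linear hp (hCb ξ)) (abs_nonneg _)
      _ = C ^ (p - 1) * (|H ξ| * |Om ξ|) := by ring
  have hDCT : Tendsto (fun δ : ℝ => ∫ ξ in Ioi (0:ℝ), (cω * (Om ξ * (p * Om ξ * (Om ξ ^ 2 + δ) ^ (p / 2 - 1)))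
        - cl * ((Om ξ ^ 2 + δ) ^ (p / 2) - δ ^ (p / 2))
        - a * (H ξ * ((Om ξ ^ 2 + δ) ^ (p / 2) - δ ^ (p / 2)))
        - 1 * (H ξ * Om ξ * (p * Om ξ * (Om ξ ^ 2 + δ) ^ (p / 2 - 1)))
        - (fun _ : ℝ => (0:ℝ)) ξ * (p * Om ξ * (Om ξ ^ 2 + δ) ^ (p / 2 - 1))))
      (𝓝[>] 0) (𝓝 (∫ ξ in Ioi (0:ℝ), ((p * cω - cl) * |Om ξ| ^ p - (a + p) * (H ξ * |Om ξ| ^ p)))) := by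
    refine tendsto_integral_filter_of_dominated_convergence
      (fun ξ => (|cω| * K₂ + |cl| * K₁) * |Om ξ| + (|a| * K₁ + K₂) * |H ξ * Om ξ|) ?_ ?_
      (((iA.const_mul _).add (iB.const_mul _)).integrableOn) ?_
    · filter_upwards [Ioc_mem_nhdsGT zero_lt_one] with δ hδ
      have hΦc : Continuous fun s : ℝ => (s ^ 2 + δ) ^ (p / 2) - δ ^ (p / 2) :=
        continuous_iff_continuousAt.mpr fun s => (hasDerivAt_powReg p hδ.1 s).continuousAt
      have hdΦc : Continuous fun s : ℝ => p * s * (s ^ 2 + δ) ^ (p / 2 - 1) :=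
        continuous_iff_continuousAt.mpr fun s => (hasDerivAt_dPowReg p hδ.1 s).continuousAt
      exact (((((continuous_const.mul (hc.mul (hdΦc.comp hc))).sub (continuous_const.mul (hΦc.comp hc))).sub
        (continuous_const.mul (hHc.mul (hΦc.comp hc)))).sub
        (continuous_const.mul ((hHc.mul hc).mul (hdΦc.comp hc)))).sub
        (continuous_const.mul (hdΦc.comp hc))).aestronglyMeasurable
    · filter_upwards [Ioc_mem_nhdsGT zero_lt_one] with δ hδ
      refine ae_of_all _ fun ξ => ?_
      rw [Real.norm_eq_abs]
      -- the same pointwise bound as in STEP 1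
      have h1a := powReg_nonneg hp0.le hδ.1.le (Om ξ)
      have h1b := hK₁ δ hδ.1 hδ.2 (Om ξ) (hCb ξ)
      have h2a := mul_dPowReg_nonneg hp0.le hδ.1.le (Om ξ)
      have h2b := hK₂ δ hδ.1 hδ.2 (Om ξ) (hCb ξ)
      have e0 : (fun _ : ℝ => (0:ℝ)) ξ * (p * Om ξ * (Om ξ ^ 2 + δ) ^ (p / 2 - 1)) = 0 := by simp
      rw [e0, sub_zero]
      have t1 : |cω * (Om ξ * (p * Om ξ * (Om ξ ^ 2 + δ) ^ (p / 2 - 1)))| ≤ |cω| * (K₂ * |Om ξ|) := by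
        rw [abs_mul, abs_of_nonneg h2a]; exact mul_le_mul_of_nonneg_left h2b (abs_nonneg _)
      have t2 : |cl * ((Om ξ ^ 2 + δ) ^ (p / 2) - δ ^ (p / 2))| ≤ |cl| * (K₁ * |Om ξ|) := by
        rw [abs_mul, abs_of_nonneg h1a]; exact mul_le_mul_of_nonneg_left h1b (abs_nonneg _)
      have t3 : |a * (H ξ * ((Om ξ ^ 2 + δ) ^ (p / 2) - δ ^ (p / 2)))| ≤ |a| * (K₁ * |H ξ * Om ξ|) := by
        rw [abs_mul, abs_mul, abs_of_nonneg h1a, abs_mul]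
        refine mul_le_mul_of_nonneg_left ?_ (abs_nonneg _)
        calc |H ξ| * ((Om ξ ^ 2 + δ) ^ (p / 2) - δ ^ (p / 2)) ≤ |H ξ| * (K₁ * |Om ξ|) :=
              mul_le_mul_of_nonneg_left h1b (abs_nonneg _)
          _ = K₁ * (|H ξ| * |Om ξ|) := by ring
      have t4 : |1 * (H ξ * Om ξ * (p * Om ξ * (Om ξ ^ 2 + δ) ^ (p / 2 - 1)))| ≤ K₂ * |H ξ * Om ξ| := by
        rw [one_mul, show H ξ * Om ξ * (p * Om ξ * (Om ξ ^ 2 + δ) ^ (p / 2 - 1))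
          = H ξ * (Om ξ * (p * Om ξ * (Om ξ ^ 2 + δ) ^ (p / 2 - 1))) by ring, abs_mul, abs_of_nonneg h2a, abs_mul]
        calc |H ξ| * (Om ξ * (p * Om ξ * (Om ξ ^ 2 + δ) ^ (p / 2 - 1))) ≤ |H ξ| * (K₂ * |Om ξ|) :=
              mul_le_mul_of_nonneg_left h2b (abs_nonneg _)
          _ = K₂ * (|H ξ| * |Om ξ|) := by ring
      have s1 := abs_sub (cω * (Om ξ * (p * Om ξ * (Om ξ ^ 2 + δ) ^ (p / 2 - 1)))
          - cl * ((Om ξ ^ 2 + δ) ^ (p / 2) - δ ^ (p / 2))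
          - a * (H ξ * ((Om ξ ^ 2 + δ) ^ (p / 2) - δ ^ (p / 2))))
        (1 * (H ξ * Om ξ * (p * Om ξ * (Om ξ ^ 2 + δ) ^ (p / 2 - 1))))
      have s2 := abs_sub (cω * (Om ξ * (p * Om ξ * (Om ξ ^ 2 + δ) ^ (p / 2 - 1)))
          - cl * ((Om ξ ^ 2 + δ) ^ (p / 2) - δ ^ (p / 2)))
        (a * (H ξ * ((Om ξ ^ 2 + δ) ^ (p / 2) - δ ^ (p / 2))))
      have s3 := abs_sub (cω * (Om ξ * (p * Om ξ * (Om ξ ^ 2 + δ) ^ (p / 2 - 1))))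
        (cl * ((Om ξ ^ 2 + δ) ^ (p / 2) - δ ^ (p / 2)))
      nlinarith [t1, t2, t3, t4, s1, s2, s3]
    · refine ae_of_all _ fun ξ => ?_
      have T1 := (tendsto_mul_dPowReg hp0 (Om ξ)).const_mul cω
      have T2 := (tendsto_powReg hp0 (Om ξ)).const_mul cl
      have T3 := ((tendsto_powReg hp0 (Om ξ)).const_mul (H ξ)).const_mul a
      have T4 := ((tendsto_mul_dPowReg hp0 (Om ξ)).const_mul (H ξ)).const_mul (1:ℝ)
      have T := ((T1.sub T2).sub T3).sub T4
      have hval : cω * (p * |Om ξ| ^ p) - cl * |Om ξ| ^ p - a * (H ξ * |Om ξ| ^ p) - 1 * (H ξ * (p * |Om ξ| ^ p))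
          = (p * cω - cl) * |Om ξ| ^ p - (a + p) * (H ξ * |Om ξ| ^ p) := by ring
      rw [hval] at T
      refine T.congr fun δ => ?_
      simp only [zero_mul, sub_zero]
      ring
  -- STEP 3: the limit of non-positive numbers is non-positive
  have hle : (∫ ξ in Ioi (0:ℝ), ((p * cω - cl) * |Om ξ| ^ p - (a + p) * (H ξ * |Om ξ| ^ p))) ≤ 0 := by
    refine le_of_tendsto hDCT ?_
    filter_upwards [Ioc_mem_nhdsGT zero_lt_one] with δ hδ using hstep δ hδ.1 hδ.2
  rw [integral_sub (iAp.const_mul _).integrableOn (iBp.const_mul _).integrableOn, integral_const_mul,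
    integral_const_mul] at hle
  exact hle

/-- **`p = 1`: THE SIGN-FREE FORM OF THE HALF-LINE IDENTITY (★)** — the mass–stretching floor. In the class of `lp_family_le`:
`(c_ω − c_l) ∫₀^∞ |Ω| ≤ (1 + a) ∫₀^∞ (HΩ)|Ω|`. For one-signed `Ω ≤ 0` on `(0,∞)` this is (★) with `εΩ′(0) ≤ 0` dropped; for
`a > −1` on the collapse sheet `c_l < c_ω` it says the stretching must correlate POSITIVELY with `|Ω|` (so `Ω ≥ 0` on `(0,∞)` is
impossible, `trivial_of_nonneg_on_Ioi`, since `∫₀^∞(HΩ)Ω ≤ 0`); at `a = −1` it empties the sheet (`sheet_empty_of_a_le_neg_one`).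
[new here — MODEL] -/
theorem abs_floor (cω cl a ε M C : ℝ) (U Om dOm ddOm : ℝ → ℝ) (hε : 0 ≤ ε)
    (hOm0 : Om 0 = 0)
    (hOm : ∀ ξ, HasDerivAt Om (dOm ξ) ξ) (hdOm : ∀ ξ, HasDerivAt dOm (ddOm ξ) ξ)
    (hM : ∀ y, |dOm y| ≤ M) (hC : ∀ y, |Om y| ≤ C / (1 + y ^ 2))
    (hU : ∀ ξ, HasDerivAt U (hilbertTransform Om ξ) ξ)
    (hF : ∀ ξ ∈ Ioi (0:ℝ), F1 cω cl a 1 ε (hilbertTransform Om) U Om dOm ddOm (fun _ => 0) ξ = 0)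
    (hUOm : Tendsto (fun ξ => U ξ * Om ξ) atTop (𝓝 0)) :
    (cω - cl) * (∫ ξ in Ioi (0:ℝ), |Om ξ|) ≤ (1 + a) * (∫ ξ in Ioi (0:ℝ), hilbertTransform Om ξ * |Om ξ|) := by
  have h := lp_family_le cω cl a ε M C 1 U Om dOm ddOm hε le_rfl hOm0 hOm hdOm hM hC hU hF hUOm
  simp only [Real.rpow_one, one_mul] at h
  linarith

/-! ### The `a ≤ −1` exclusions -/

/-- **For `a ≤ −1` the collapse sheet `{c_l < |a|·c_ω}` is EMPTY — sign-free, every `ε ≥ 0`.** An odd `C²` profile with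
`|Ω′| ≤ M`, `|Ω(ξ)| ≤ C/(1+ξ²)`, `𝒰′ = HΩ` (genuine Hilbert transform), `𝒰Ω → 0`, solving `F₁(c_ω, c_l, a, 1, ε) ≡ 0` on `(0,∞)`
with `a ≤ −1`, `c_l < (−a)·c_ω`, `ε ≥ 0`, is `≡ 0`: the member `p = |a|` of `lp_family_le` reads `(|a|c_ω − c_l)∫₀^∞|Ω|^{|a|} ≤ 0`.
Contains `trivial_of_a_eq_neg_two` (`a = −2`) and, sign-free, `nsTypeLine_ESigned_empty_of_a_le_neg_one`; the steady shadow of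
[Chen 2020, Thm 1.5] (`‖ω‖_{L^{|a|}}` non-increasing for `a ≤ −1`). CLASS CAVEAT: the `ξ⁻²` envelope is the natural tail exactly
on the NS-type line `c_l = c_ω/2` (`Ω ~ Aξ^{−c_ω/c_l}`); for `c_ω/2 < c_l < |a|c_ω` the generic algebraic tail is SLOWER than `ξ⁻²`
and the envelope is then a genuine restriction (the inviscid `a < 0` collapse profiles of [Lushnikov–Silantyev–Siegel 2021, §5]
have tails `ξ^{−1/α}`, `α > 1`, outside this class). [new here — MODEL] -/
theorem sheet_empty_of_a_le_neg_one (cω cl a ε M C : ℝ) (U Om dOm ddOm : ℝ → ℝ) (hε : 0 ≤ ε) (ha : a ≤ -1)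
    (hcl : cl < -a * cω)
    (hodd : ∀ y, Om (-y) = -Om y)
    (hOm : ∀ ξ, HasDerivAt Om (dOm ξ) ξ) (hdOm : ∀ ξ, HasDerivAt dOm (ddOm ξ) ξ)
    (hM : ∀ y, |dOm y| ≤ M) (hC : ∀ y, |Om y| ≤ C / (1 + y ^ 2))
    (hU : ∀ ξ, HasDerivAt U (hilbertTransform Om ξ) ξ)
    (hF : ∀ ξ ∈ Ioi (0:ℝ), F1 cω cl a 1 ε (hilbertTransform Om) U Om dOm ddOm (fun _ => 0) ξ = 0)
    (hUOm : Tendsto (fun ξ => U ξ * Om ξ) atTop (𝓝 0)) : Om = 0 := by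
  have hOm0 : Om 0 = 0 := by
    have h := hodd 0
    simp only [neg_zero] at h
    linarith
  have hp : (1:ℝ) ≤ -a := by linarith
  have h := lp_family_le cω cl a ε M C (-a) U Om dOm ddOm hε hp hOm0 hOm hdOm hM hC hU hF hUOm
  rw [show a + -a = 0 by ring, zero_mul, sub_zero] at h
  -- `∫₀^∞ |Ω|^{|a|} = 0`
  have hc : Continuous Om := continuous_iff_continuousAt.mpr fun x => (hOm x).continuousAt
  have hC0 : 0 ≤ C := env_const_nonneg hC
  have hCb : ∀ y, |Om y| ≤ C := fun y => (hC y).trans (div_le_self hC0 (by nlinarith [sq_nonneg y]))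
  have hpc : Continuous fun ξ => |Om ξ| ^ (-a) := (continuous_abs.comp hc).rpow_const fun _ => Or.inr (by linarith)
  have iAp : Integrable fun ξ => |Om ξ| ^ (-a) := by
    refine ((integrable_of_env hc hC).abs.const_mul (C ^ (-a - 1))).mono' hpc.aestronglyMeasurable
      (ae_of_all _ fun ξ => ?_)
    rw [Real.norm_eq_abs, abs_of_nonneg (Real.rpow_nonneg (abs_nonneg _) _)]
    exact abs_rpow_le_linear hp (hCb ξ)
  have hnn : 0 ≤ ∫ ξ in Ioi (0:ℝ), |Om ξ| ^ (-a) := integral_nonneg fun ξ => Real.rpow_nonneg (abs_nonneg _) _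
  have hcoef : 0 < -a * cω - cl := by linarith
  have hI0 : ∫ ξ in Ioi (0:ℝ), |Om ξ| ^ (-a) = 0 := by
    by_contra hne
    have hpos : 0 < ∫ ξ in Ioi (0:ℝ), |Om ξ| ^ (-a) := lt_of_le_of_ne hnn (Ne.symm hne)
    nlinarith
  have hz := eqOn_zero_of_nonneg_of_integral_eq_zero hpc.continuousOn (fun ξ _ => Real.rpow_nonneg (abs_nonneg _) _)
    iAp.integrableOn hI0
  refine eq_zero_of_odd_of_eqOn_Ioi hodd fun ξ hξ => ?_
  exact eq_zero_of_abs_rpow_eq_zero (by linarith : -a ≠ 0) (hz hξ)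

/-- **THE CENSUS DECL: for EVERY `a ≤ −1` the NS-type line carries NO profile — sign-free, every `ε ≥ 0`.** On the NS-type
line `c_l = c_ω/2` of the gCLM/OSW sheet (`Literature.Analysis.FluidPDE.effectiveViscosity_half`; blow-up `c_ω > 0`, ANY gauge,
ANY `ε ≥ 0`), for every `a ≤ −1`: an odd `C²` profile `Ω` (`Ω′ = dOm`, `Ω″ = ddOm`) with `|Ω′| ≤ M`, `|Ω(ξ)| ≤ C/(1+ξ²)`, MODEL
velocity `𝒰` (`𝒰′ = HΩ`, genuine Hilbert transform) with `𝒰(ξ)Ω(ξ) → 0`, solving `F₁(c_ω, c_ω/2, a, 1, ε) ≡ 0` on `(0,∞)`,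
is `≡ 0`. NO SIGN HYPOTHESIS (compare `nsTypeLine_ESigned_empty_of_a_le_neg_one`, `nsTypeLine_ESigned_empty_of_a_neg`, whose
decay classes it contains on `a ≤ −1`). Proof: `sheet_empty_of_a_le_neg_one` with `c_ω/2 < |a|c_ω`. [new here — MODEL] -/
theorem nsTypeLine_empty_of_a_le_neg_one (cω a ε M C : ℝ) (U Om dOm ddOm : ℝ → ℝ) (hcω : 0 < cω) (hε : 0 ≤ ε)
    (ha : a ≤ -1)
    (hodd : ∀ y, Om (-y) = -Om y)
    (hOm : ∀ ξ, HasDerivAt Om (dOm ξ) ξ) (hdOm : ∀ ξ, HasDerivAt dOm (ddOm ξ) ξ)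
    (hM : ∀ y, |dOm y| ≤ M) (hC : ∀ y, |Om y| ≤ C / (1 + y ^ 2))
    (hU : ∀ ξ, HasDerivAt U (hilbertTransform Om ξ) ξ)
    (hF : ∀ ξ ∈ Ioi (0:ℝ), F1 cω (cω / 2) a 1 ε (hilbertTransform Om) U Om dOm ddOm (fun _ => 0) ξ = 0)
    (hUOm : Tendsto (fun ξ => U ξ * Om ξ) atTop (𝓝 0)) : Om = 0 :=
  sheet_empty_of_a_le_neg_one cω (cω / 2) a ε M C U Om dOm ddOm hε ha (by nlinarith) hodd hOm hdOm hM hC hU hF hUOm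

/-- **Corollary in the census velocity class** (the binders of `nsTypeLine_ESigned_empty_of_a_neg` with `a ≤ −1`, NO sign
hypothesis, `ε ≥ 0`): the class hypothesis `ξ𝒰(ξ)Ω(ξ) → 0` implies `𝒰Ω → 0`, so `Ω ≡ 0`. (`hU0`, `iUOm`, `iH`, `hdOm1` are listed
only to place the statement in that class; they are not used.) [new here — MODEL] -/
theorem nsTypeLine_empty_of_a_le_neg_one_velocityClass (cω a ε M C : ℝ) (U Om dOm ddOm : ℝ → ℝ) (hcω : 0 < cω)
    (hε : 0 ≤ ε) (ha : a ≤ -1)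
    (hodd : ∀ y, Om (-y) = -Om y)
    (hOm : ∀ ξ, HasDerivAt Om (dOm ξ) ξ) (hdOm : ∀ ξ, HasDerivAt dOm (ddOm ξ) ξ)
    (hM : ∀ y, |dOm y| ≤ M) (hC : ∀ y, |Om y| ≤ C / (1 + y ^ 2))
    (hU : ∀ ξ, HasDerivAt U (hilbertTransform Om ξ) ξ) (hU0 : U 0 = 0)
    (hF : ∀ ξ ∈ Ioi (0:ℝ), F1 cω (cω / 2) a 1 ε (hilbertTransform Om) U Om dOm ddOm (fun _ => 0) ξ = 0)
    (iUOm : IntegrableOn (fun ξ => U ξ * Om ξ) (Ioi 0))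
    (iH : IntegrableOn (fun ξ => ξ * (hilbertTransform Om ξ * Om ξ)) (Ioi 0))
    (hUOm : Tendsto (fun R => R * U R * Om R) atTop (𝓝 0))
    (hdOm1 : Tendsto (fun R => R * dOm R) atTop (𝓝 0)) : Om = 0 := by
  have _h1 := hU0; have _h2 := iUOm; have _h3 := iH; have _h4 := hdOm1
  -- `ξ𝒰Ω → 0 ⇒ 𝒰Ω → 0`
  have hUOm' : Tendsto (fun ξ => U ξ * Om ξ) atTop (𝓝 0) := by
    have hinv : Tendsto (fun R : ℝ => R⁻¹) atTop (𝓝 0) := tendsto_inv_atTop_zero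
    have h := hUOm.mul hinv
    rw [mul_zero] at h
    refine h.congr' ?_
    filter_upwards [Ioi_mem_atTop (0:ℝ)] with R hR
    have hR' : R ≠ 0 := ne_of_gt hR
    field_simp
  exact nsTypeLine_empty_of_a_le_neg_one cω a ε M C U Om dOm ddOm hcω hε ha hodd hOm hdOm hM hC hU hF hUOm'

end SheetHalfLine
end Summit.NavierStokesRegularity.OSWSelfSimilar
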